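import Summits.RiemannHypothesis.RiemannHypothesis.Theorems.LiTailLaguerreSilentEcho
import Summits.RiemannHypothesis.RiemannHypothesis.Theorems.LiTailLaguerreRungSilent
import HarnessLib

/-!
# RiemannHypothesis / LiTailLaguerre — the companions of the leaf: TAIL SILENCE via the landed rung, and the ECHO STAIRCASE
in Laguerre form (RH-FREE)

RH-FREE [rh-li-eng-4].  Route `Theses/LiTailLaguerre.lean` (rung «Li TAIL–LAGUERRE LAW» `LiTheory.LiZeroTailLaguerre`,
L-P(P1-tail); cell `pub/rh-li`, theory round 7).  Two things:

* `liZeroTailSilent_of_gammaShift : LiGammaTailShift → LiZeroTailSilent` and `liZeroTailEcho_of_gammaShift :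
  LiGammaTailShift → LiZeroTailEcho` — the composition `liZeroTailSilent_of_rung` (module `LiTailLaguerreSilentEcho`) with
  its rung hypothesis DISCHARGED by the landed BC5 rung `RungSilent.stub_rung_silent` (tail-p1, p461299): PART K's companions
  T3f₀/T3f wait only for the binder K3′ `LiGammaTailShift`, not for the deciding crux K2′ and not for a Fejér asymptotic.
* `liZeroWindowLaguerre_of_laguerre` — the column's structure statement for the oscillatory part of `λ_n` is the WINDOW
  ECHO LAW T3e (`LiZeroWindowEchoes`, PART D): «the zeros of height `(c₁√n, c₂√n]` echo exactly the prime powers `m` with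
  `c₂^{−2} ≤ log m < c₁^{−2}`», typed with the Fejér chirps `liPrimeEcho m n` as main terms.  Differencing the TAIL law at the
  two cuts gives the same staircase with the EXACT Laguerre terms of the arithmetic formula as main terms and no stationary
  phase anywhere: `LiZeroTailLaguerre →` for all admissible `0 < c₁ ≤ c₂` (no prime power with `log m = 1/c₁²` or
  `= 1/c₂²`) there is `C` with, for all `n ≥ 2`,
  `|liZeroTraceWindow n (c₁√n) (c₂√n) − liSmoothTraceWindow n (c₁√n) (c₂√n)
      − (Σ_{2 ≤ m ≤ e^{1/c₁²}} liCoffeyTerm m n − Σ_{2 ≤ m ≤ e^{1/c₂²}} liCoffeyTerm m n)| ≤ C log² n`,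
  i.e. the window hears `Σ_{e^{1/c₂²} < m ≤ e^{1/c₁²}} (Λ(m)/m) L¹_{n−1}(log m)`.  Proof: the exact differencing identity
  `SilentEcho.tail_sub_smooth_eq` (Backlund's `N = θ/π + 1 + S`), the leaf at `c₁` and at `c₂`, and
  `|S(T)| ≤ 0.3083 log T + 3.24` (`abs_zetaArgS_le_explicit`).  DATA: this is the law ECHO-X measured (DATA.md §N, kit
  j252784: 13 windows, `n ≤ 4.8·10¹²`, `sup |D − P₅₀| ≤ 3.3`) and the staircase of §M/§F (`c_m = (log m)^{−1/2}`).

Nothing here bears on the truth of RH: RH-free consequences of RH-free statements; no zero is assumed on the critical line.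
-/

noncomputable section

-- D-0017: `Summit.<S>.<S>.…` is the designed namespace of a single-problem summit.
set_option linter.dupNamespace false

open scoped ArithmeticFunction.vonMangoldt

namespace Summit.RiemannHypothesis.RiemannHypothesis.Theorems.LiTheory

open Summit.RiemannHypothesis.RiemannHypothesis.Theses.LiTailLaguerre
open Literature.NumberTheory.LFunctions

/-- **TAIL SILENCE waits only for K3′ (RH-FREE composition):** `LiGammaTailShift → LiZeroTailSilent`, the rung hypothesis
of `liZeroTailSilent_of_rung` discharged by the landed `RungSilent.stub_rung_silent`. -/
theorem liZeroTailSilent_of_gammaShift (hD : LiGammaTailShift) : LiZeroTailSilent :=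
  liZeroTailSilent_of_rung hD RungSilent.stub_rung_silent

/-- **TAIL ECHO waits only for K3′ (RH-FREE composition):** `LiGammaTailShift → LiZeroTailEcho`. -/
theorem liZeroTailEcho_of_gammaShift (hD : LiGammaTailShift) : LiZeroTailEcho :=
  liZeroTailEcho_of_silent (liZeroTailSilent_of_gammaShift hD)

/-- **The window staircase in Laguerre form, from the leaf (RH-FREE).**  For admissible cuts `0 < c₁ ≤ c₂` the windowed Li
trace minus its smooth mean equals the Coffey–Laguerre terms of the prime powers `e^{1/c₂²} < m ≤ e^{1/c₁²}` up to
`O(log² n)`. -/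
theorem liZeroWindowLaguerre_of_laguerre (h : LiZeroTailLaguerre) :
    ∀ c₁ c₂ : ℝ, 0 < c₁ → c₁ ≤ c₂ →
      (∀ m : ℕ, 2 ≤ m → (Λ m : ℝ) ≠ 0 → Real.log m ≠ 1 / c₁ ^ 2) →
      (∀ m : ℕ, 2 ≤ m → (Λ m : ℝ) ≠ 0 → Real.log m ≠ 1 / c₂ ^ 2) →
      ∃ C : ℝ, ∀ n : ℕ, 2 ≤ n →
        |liZeroTraceWindow n (c₁ * Real.sqrt n) (c₂ * Real.sqrt n)
            - liSmoothTraceWindow n (c₁ * Real.sqrt n) (c₂ * Real.sqrt n)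
            - (∑ m ∈ Finset.Icc 2 ⌊Real.exp (1 / c₁ ^ 2)⌋₊, liCoffeyTerm m n
                - ∑ m ∈ Finset.Icc 2 ⌊Real.exp (1 / c₂ ^ 2)⌋₊, liCoffeyTerm m n)|
          ≤ C * Real.log n ^ 2 := by
  intro c₁ c₂ hc₁ hc₁₂ hedge₁ hedge₂
  have hc₂ : 0 < c₂ := hc₁.trans_le hc₁₂
  obtain ⟨C₁, hC₁⟩ := h c₁ hc₁ hedge₁
  obtain ⟨C₂, hC₂⟩ := h c₂ hc₂ hedge₂
  obtain ⟨N₀, hN₀⟩ := exists_nat_gt ((30 / c₁) ^ 2 + c₂ ^ 2 + 900)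
  refine PrimeEchoAssembly.eventually_to_all _ N₀ (C₁ + C₂ + 15) fun n hn h2 ↦ ?_
  have hnN₀ : (N₀ : ℝ) ≤ n := by exact_mod_cast hn
  set s : ℝ := Real.sqrt n with hs_def
  have hn0 : (0 : ℝ) ≤ n := Nat.cast_nonneg n
  have hs_sq : s ^ 2 = n := Real.sq_sqrt hn0
  have hs0 : 0 ≤ s := Real.sqrt_nonneg _
  have h30c : 0 < 30 / c₁ := by positivity
  have hs1 : 30 / c₁ ≤ s := by
    rw [← Real.sqrt_sq h30c.le]
    exact Real.sqrt_le_sqrt (by nlinarith [sq_nonneg c₂])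
  have hs2 : c₂ ≤ s := by
    rw [← Real.sqrt_sq hc₂.le]
    exact Real.sqrt_le_sqrt (by nlinarith [sq_nonneg (30 / c₁)])
  have hs900 : (30 : ℝ) ≤ s := by
    have : Real.sqrt 900 = 30 := by
      rw [show (900 : ℝ) = 30 ^ 2 by norm_num]; exact Real.sqrt_sq (by norm_num)
    rw [← this]; exact Real.sqrt_le_sqrt (by nlinarith [sq_nonneg c₂, sq_nonneg (30 / c₁)])
  have ha30 : 30 ≤ c₁ * s := by
    have := mul_le_mul_of_nonneg_left hs1 hc₁.le
    rwa [mul_div_cancel₀ _ hc₁.ne'] at this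
  have ha0 : 0 < c₁ * s := by linarith
  have hab : c₁ * s ≤ c₂ * s := mul_le_mul_of_nonneg_right hc₁₂ hs0
  have hbn : c₂ * s ≤ n := by nlinarith
  have hid := SilentEcho.tail_sub_smooth_eq n ha0 hab
  have hS := SilentEcho.abs_two_mul_zetaArgS_sub_le ha30 hab hbn
  have h1 := hC₁ n h2
  have h2' := hC₂ n h2
  have hlog1 : 1 ≤ Real.log n := by
    have hn3 : (3 : ℝ) ≤ n := by nlinarith
    rw [Real.le_log_iff_exp_le (by linarith)]
    have := Real.exp_one_lt_d9; linarith
  have hlogsq : Real.log n ≤ Real.log n ^ 2 := by nlinarith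
  have e : liZeroTraceWindow n (c₁ * s) (c₂ * s) - liSmoothTraceWindow n (c₁ * s) (c₂ * s)
        - (∑ m ∈ Finset.Icc 2 ⌊Real.exp (1 / c₁ ^ 2)⌋₊, liCoffeyTerm m n
            - ∑ m ∈ Finset.Icc 2 ⌊Real.exp (1 / c₂ ^ 2)⌋₊, liCoffeyTerm m n)
      = (liZeroTail n (c₂ * s) - liSmoothTail n (c₂ * s)
            + ∑ m ∈ Finset.Icc 2 ⌊Real.exp (1 / c₂ ^ 2)⌋₊, liCoffeyTerm m n)
        - (liZeroTail n (c₁ * s) - liSmoothTail n (c₁ * s)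
            + ∑ m ∈ Finset.Icc 2 ⌊Real.exp (1 / c₁ ^ 2)⌋₊, liCoffeyTerm m n)
        + 2 * (zetaArgS (c₂ * s) - zetaArgS (c₁ * s)) := by
    rw [hid]; ring
  rw [e]
  rw [abs_le] at hS h1 h2' ⊢
  constructor <;> nlinarith [hS.1, hS.2, h1.1, h1.2, h2'.1, h2'.2, hlog1, hlogsq]

/-- **SILENT WINDOW from the leaf (RH-FREE; T3d₀ of PART D, NO Fejér asymptotic needed):** for `1 < c ≤ 23/20` both cuts
`√n` and `c√n` release exactly the prime power `2` (`⌊e⌋ = ⌊e^{1/c²}⌋ = 2`), so the Laguerre staircase has NO step in the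
window and `LiZeroWindowSilent` follows. -/
theorem liZeroWindowSilent_of_laguerre (h : LiZeroTailLaguerre) : LiZeroWindowSilent := by
  intro c hc1 hc2
  have hc0 : 0 < c := by linarith
  have hcsq : c ^ 2 ≤ 529 / 400 := by nlinarith
  have hge : (400 : ℝ) / 529 ≤ 1 / c ^ 2 := by
    rw [div_le_div_iff₀ (by norm_num) (by positivity)]; nlinarith
  have hlt1 : 1 / c ^ 2 < 1 := by
    rw [div_lt_one (by positivity)]; nlinarith
  have hlog2 : Real.log 2 < 1 / c ^ 2 := by
    have h1 := Real.log_two_lt_d9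
    have h2 : (0.6931471808 : ℝ) ≤ 400 / 529 := by norm_num
    linarith
  have hedge1 : ∀ m : ℕ, 2 ≤ m → (Λ m : ℝ) ≠ 0 → Real.log m ≠ 1 / (1 : ℝ) ^ 2 := by
    intro m hm _
    rw [one_pow, div_one]
    rcases Nat.lt_or_ge m 3 with h3 | h3
    · have hm2 : m = 2 := by omega
      subst hm2
      push_cast
      intro heq; rw [heq] at hlog2; linarith
    · have h3' : (3 : ℝ) ≤ m := by exact_mod_cast h3
      have h1 : 1 < Real.log m := by
        refine (Real.lt_log_iff_exp_lt (by positivity)).2 (lt_of_lt_of_le ?_ h3')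
        have := Real.exp_one_lt_d9
        norm_num at this ⊢; linarith
      exact ne_of_gt h1
  have hedge2 : ∀ m : ℕ, 2 ≤ m → (Λ m : ℝ) ≠ 0 → Real.log m ≠ 1 / c ^ 2 := by
    intro m hm _
    rcases Nat.lt_or_ge m 3 with h3 | h3
    · have hm2 : m = 2 := by omega
      subst hm2
      push_cast
      exact ne_of_lt hlog2
    · have h3' : (3 : ℝ) ≤ m := by exact_mod_cast h3
      have h1 : 1 < Real.log m := by
        refine (Real.lt_log_iff_exp_lt (by positivity)).2 (lt_of_lt_of_le ?_ h3')
        have := Real.exp_one_lt_d9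
        norm_num at this ⊢; linarith
      intro heq; rw [heq] at h1; linarith
  obtain ⟨C, hC⟩ := liZeroWindowLaguerre_of_laguerre h 1 c one_pos hc1.le hedge1 hedge2
  refine ⟨C, fun n hn ↦ ?_⟩
  have key := hC n hn
  have hflc : ⌊Real.exp (1 / c ^ 2)⌋₊ = 2 := by
    rw [Nat.floor_eq_iff (Real.exp_pos _).le]
    constructor
    · calc ((2 : ℕ) : ℝ) = Real.exp (Real.log 2) := by rw [Real.exp_log two_pos]; norm_num
        _ ≤ Real.exp (1 / c ^ 2) := Real.exp_le_exp.2 hlog2.le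
    · calc Real.exp (1 / c ^ 2) ≤ Real.exp 1 := Real.exp_le_exp.2 hlt1.le
        _ < (2 : ℕ) + 1 := by have := Real.exp_one_lt_d9; norm_num at this ⊢; linarith
  rw [floor_exp_one_div_one_sq, hflc, sub_self, sub_zero, one_mul] at key
  exact key

/-- **WINDOW ECHO LAW T3e from the leaf and the WEAK FEJÉR law (RH-FREE):** `LiZeroTailLaguerre →` (for every prime
power scale `m ≥ 2`, `liCoffeyTerm m n + liPrimeEcho m n = O_m(1)`) `→ LiZeroWindowEchoes`.  The Laguerre staircase
`liZeroWindowLaguerre_of_laguerre` releases, between the cuts `c₁√n < c₂√n`, exactly the `m` with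
`e^{1/c₂²} < m ≤ e^{1/c₁²}`; the weak Fejér law (the hypothesis, eng g6's target; classical: Fejér 1909 / Szegő Thm 8.22.1)
turns each Laguerre term into minus the chirp `E_m(n)` at bounded cost. -/
theorem liZeroWindowEchoes_of_laguerre_of_fejer (h : LiZeroTailLaguerre)
    (hF : ∀ m : ℕ, 2 ≤ m → ∃ C : ℝ, ∀ n : ℕ, 1 ≤ n → |liCoffeyTerm m n + liPrimeEcho m n| ≤ C) :
    LiZeroWindowEchoes := by
  intro c₁ c₂ hc₁ hc₁₂ hedge
  have hc₂ : 0 < c₂ := hc₁.trans hc₁₂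
  obtain ⟨C₀, hC₀⟩ := liZeroWindowLaguerre_of_laguerre h c₁ c₂ hc₁ hc₁₂.le
    (fun m hm hΛ ↦ (hedge m hm hΛ).1) (fun m hm hΛ ↦ (hedge m hm hΛ).2)
  choose! Cf hCf using hF
  set M₁ := ⌊Real.exp (1 / c₁ ^ 2)⌋₊ with hM₁
  set M₂ := ⌊Real.exp (1 / c₂ ^ 2)⌋₊ with hM₂
  have h12 : 1 / c₂ ^ 2 ≤ 1 / c₁ ^ 2 :=
    one_div_le_one_div_of_le (by positivity) (pow_le_pow_left₀ hc₁.le hc₁₂.le 2)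
  have hM : M₂ ≤ M₁ := Nat.floor_mono (Real.exp_le_exp.2 h12)
  set K : ℝ := ∑ m ∈ Finset.Icc 2 M₁, Cf m with hK
  set ℓ : ℝ := Real.log 2 with hℓ_def
  have hℓ : 0 < ℓ := Real.log_pos (by norm_num)
  have hK0 : 0 ≤ K := Finset.sum_nonneg fun m hm ↦
    (abs_nonneg _).trans (hCf m (Finset.mem_Icc.1 hm).1 1 le_rfl)
  refine ⟨C₀ + K / ℓ ^ 2, fun n hn ↦ ?_⟩
  have key := hC₀ n hn
  have hn1 : 1 ≤ n := by omega
  -- the released terms between the two cuts, as a filtered sum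
  have hsum : ∑ m ∈ Finset.Icc 2 M₁, liCoffeyTerm m n - ∑ m ∈ Finset.Icc 2 M₂, liCoffeyTerm m n
      = ∑ m ∈ Finset.Icc 2 M₁, (if 1 / c₂ ^ 2 ≤ Real.log m then liCoffeyTerm m n else 0) := by
    have hsub : (Finset.Icc 2 M₁).filter (fun m ↦ m ≤ M₂) = Finset.Icc 2 M₂ := by
      ext m
      simp only [Finset.mem_filter, Finset.mem_Icc]
      omega
    rw [← hsub, Finset.sum_filter, ← Finset.sum_sub_distrib]
    refine Finset.sum_congr rfl fun m hm ↦ ?_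
    obtain ⟨hm2, -⟩ := Finset.mem_Icc.1 hm
    have hm0 : (0 : ℝ) < m := by exact_mod_cast (show 0 < m by omega)
    by_cases hle : m ≤ M₂
    · rw [if_pos hle, sub_self]
      by_cases hcond : 1 / c₂ ^ 2 ≤ Real.log m
      · rw [if_pos hcond]
        have hmle : (m : ℝ) ≤ Real.exp (1 / c₂ ^ 2) :=
          (show (m : ℝ) ≤ M₂ by exact_mod_cast hle).trans (Nat.floor_le (Real.exp_pos _).le)
        have hlogle : Real.log m ≤ 1 / c₂ ^ 2 := by
          have := Real.log_le_log hm0 hmle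
          rwa [Real.log_exp] at this
        have heq : Real.log m = 1 / c₂ ^ 2 := le_antisymm hlogle hcond
        have hΛ : (Λ m : ℝ) = 0 := by
          by_contra hne
          exact (hedge m hm2 hne).2 heq
        simp [liCoffeyTerm, hΛ]
      · rw [if_neg hcond]
    · rw [if_neg hle, sub_zero]
      have hgt : Real.exp (1 / c₂ ^ 2) < m := Nat.lt_of_floor_lt (not_le.1 hle)
      have hcond : 1 / c₂ ^ 2 ≤ Real.log m := by
        have := Real.log_lt_log (Real.exp_pos _) hgt
        rw [Real.log_exp] at this
        exact this.le
      rw [if_pos hcond]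
  -- the weak Fejér law on the released terms
  have hfe : |∑ m ∈ Finset.Icc 2 M₁,
      (if 1 / c₂ ^ 2 ≤ Real.log m then liCoffeyTerm m n + liPrimeEcho m n else 0)| ≤ K := by
    refine (Finset.abs_sum_le_sum_abs _ _).trans (Finset.sum_le_sum fun m hm ↦ ?_)
    obtain ⟨hm2, -⟩ := Finset.mem_Icc.1 hm
    split_ifs with hcnd
    · exact hCf m hm2 n hn1
    · rw [abs_zero]; exact (abs_nonneg _).trans (hCf m hm2 n hn1)
  have hsplit : ∑ m ∈ Finset.Icc 2 M₁,
      (if 1 / c₂ ^ 2 ≤ Real.log m then liCoffeyTerm m n + liPrimeEcho m n else 0)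
      = ∑ m ∈ Finset.Icc 2 M₁, (if 1 / c₂ ^ 2 ≤ Real.log m then liCoffeyTerm m n else 0)
        + ∑ m ∈ Finset.Icc 2 M₁, (if 1 / c₂ ^ 2 ≤ Real.log m then liPrimeEcho m n else 0) := by
    rw [← Finset.sum_add_distrib]
    refine Finset.sum_congr rfl fun m _ ↦ ?_
    split_ifs <;> ring
  have e : liZeroTraceWindow n (c₁ * Real.sqrt n) (c₂ * Real.sqrt n)
        - liSmoothTraceWindow n (c₁ * Real.sqrt n) (c₂ * Real.sqrt n)
        + ∑ m ∈ Finset.Icc 2 M₁, (if 1 / c₂ ^ 2 ≤ Real.log m then liPrimeEcho m n else 0)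
      = (liZeroTraceWindow n (c₁ * Real.sqrt n) (c₂ * Real.sqrt n)
          - liSmoothTraceWindow n (c₁ * Real.sqrt n) (c₂ * Real.sqrt n)
          - (∑ m ∈ Finset.Icc 2 M₁, liCoffeyTerm m n - ∑ m ∈ Finset.Icc 2 M₂, liCoffeyTerm m n))
        + ∑ m ∈ Finset.Icc 2 M₁,
            (if 1 / c₂ ^ 2 ≤ Real.log m then liCoffeyTerm m n + liPrimeEcho m n else 0) := by
    rw [hsplit, hsum]; ring
  rw [e]
  have hlog : ℓ ≤ Real.log n := Real.log_le_log (by norm_num) (by exact_mod_cast hn)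
  have hL1 : (1 : ℝ) ≤ Real.log n ^ 2 / ℓ ^ 2 := by
    rw [one_le_div (by positivity)]; exact pow_le_pow_left₀ hℓ.le hlog 2
  have hKb : K ≤ K / ℓ ^ 2 * Real.log n ^ 2 := by
    have : K / ℓ ^ 2 * Real.log n ^ 2 = K * (Real.log n ^ 2 / ℓ ^ 2) := by ring
    rw [this]; exact le_mul_of_one_le_right hK0 hL1
  calc |liZeroTraceWindow n (c₁ * Real.sqrt n) (c₂ * Real.sqrt n)
          - liSmoothTraceWindow n (c₁ * Real.sqrt n) (c₂ * Real.sqrt n)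
          - (∑ m ∈ Finset.Icc 2 M₁, liCoffeyTerm m n - ∑ m ∈ Finset.Icc 2 M₂, liCoffeyTerm m n)
        + ∑ m ∈ Finset.Icc 2 M₁,
            (if 1 / c₂ ^ 2 ≤ Real.log m then liCoffeyTerm m n + liPrimeEcho m n else 0)|
      ≤ |liZeroTraceWindow n (c₁ * Real.sqrt n) (c₂ * Real.sqrt n)
          - liSmoothTraceWindow n (c₁ * Real.sqrt n) (c₂ * Real.sqrt n)
          - (∑ m ∈ Finset.Icc 2 M₁, liCoffeyTerm m n - ∑ m ∈ Finset.Icc 2 M₂, liCoffeyTerm m n)|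
        + |∑ m ∈ Finset.Icc 2 M₁,
            (if 1 / c₂ ^ 2 ≤ Real.log m then liCoffeyTerm m n + liPrimeEcho m n else 0)| := abs_add_le _ _
    _ ≤ C₀ * Real.log n ^ 2 + K := add_le_add key hfe
    _ ≤ C₀ * Real.log n ^ 2 + K / ℓ ^ 2 * Real.log n ^ 2 := by linarith
    _ = (C₀ + K / ℓ ^ 2) * Real.log n ^ 2 := by ring

end Summit.RiemannHypothesis.RiemannHypothesis.Theorems.LiTheory

end
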